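import Literature.Algebra.Homology.OrderedCechPairSystem
import HarnessLib

/-!
# Functoriality of the ordered Čech bicomplex of a pair-system (Stacks 0BEC, 012K)

Layer `Literature/Algebra/Homology` (constructions + proved lemmas; 0 named facts, no instance, no notation; pure homological
algebra over a commutative ring `A`). Sequel to `Algebra/Homology/OrderedCechPairSystem` (`sysBicomplex P`, the ordered Čech
bicomplex `Čᵃ,ᵇ(P) = Π_τ Π_σ P σ τ` of a pair-system `P : Finset ι ⥤ Finset κ ⥤ ModuleCat A`): a morphism of pair-systems
`φ : P ⟶ P'` (maps `P σ τ → P' σ τ` natural in BOTH variables, defined on ALL pairs) induces, componentwise,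

* `cochainSystemMap φ a : cochainSystem P a ⟶ cochainSystem P' a` — the map of `κ`-systems of `σ`-cochains
  (`Functor.whiskerRight` of the flipped transformation along `sysCochainFunctor`), commuting with the `σ`-differentials
  (`cochainSystemD_naturality`, from `OrderedCechSystemMap.sysD_sysCochainMap`);
* **`sysBicomplexMap φ : sysBicomplex P ⟶ sysBicomplex P'`** — columnwise `sysComplexMap (cochainSystemMap φ a)`; element formula
  `sysBicomplexMap_f_f_apply` (`x ↦ ((τ, σ) ↦ φ σ τ (x τ σ))`), `sysBicomplexMap_id`, `_comp`, `_zero`, `_add`;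
* **`sysBicomplexFunctor A ι κ : (Finset ι ⥤ Finset κ ⥤ ModuleCat A) ⥤ HomologicalComplex₂ (ModuleCat A) (up ℤ) (up ℤ)`**, additive
  (`additive_sysBicomplexFunctor`, a theorem), and `sysBicomplexMapIso` for isomorphisms of pair-systems.

For isomorphisms given on NON-EMPTY pairs only see `Algebra/Homology/OrderedCechPairSystemMap.sysBicomplexIsoNE` (not restated
here; on an everywhere-defined isomorphism both constructions have the same components `e σ τ`). Library only (cell
`pub-hodge-ring2`, count-neutral); proves nothing about any crux, route or conjecture. Mathlib searched (pin v4.32):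
`CategoryTheory.flipFunctor`, `Functor.whiskerRight`, `CochainComplex.ofHom`, `Functor.mapIso`, `Functor.Additive` (used).

## References

* The Stacks Project, Tag 0BEC (Künneth: the double Čech complex), Tag 012K (double complexes), Tag 01FG. [StacksProject]
* U. Görtz, T. Wedhorn, *Algebraic Geometry II* (2023), Def. 21.68 (p. 180). [GortzWedhorn2023]
-/

universe u

open CategoryTheory

set_option backward.isDefEq.respectTransparency false

noncomputable section

namespace Literature.Algebra.Homology

namespace OrderedCech

variable {A : Type u} [CommRing A] {ι κ : Type} [LinearOrder ι] [LinearOrder κ]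
  {P P' P'' : Finset ι ⥤ Finset κ ⥤ ModuleCat.{u} A} (φ : P ⟶ P') (ψ : P' ⟶ P'')

/-! ### §1 The induced maps of `κ`-systems of `σ`-cochains -/

/-- **`Čᵃ(P(·, t)) → Čᵃ(P'(·, t))`, natural in `t`**: the map of `κ`-systems of `σ`-cochains induced by `φ` (componentwise
`sysCochainMap` of the `ι`-system morphism `s ↦ φ s t`). [cite: GortzWedhorn2023, Def. 21.68 (p. 180)] [cite: StacksProject, Tag 0BEC] -/
def cochainSystemMap (a : ℤ) : cochainSystem P a ⟶ cochainSystem P' a :=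
  Functor.whiskerRight ((flipFunctor _ _ _).map φ) (sysCochainFunctor A ι a)

omit [LinearOrder κ] in
/-- Components: `(φ_* g)_σ = φ σ t (g_σ)` (`rfl`). [cite: GortzWedhorn2023, Def. 21.68 (p. 180)] -/
@[simp] theorem cochainSystemMap_app_apply (a : ℤ) (t : Finset κ) (g : SysCochain (P.flip.obj t) a) (σ : Simplex ι a) :
    (((cochainSystemMap φ a).app t).hom g : SysCochain (P'.flip.obj t) a) σ = ((φ.app σ.1).app t).hom (g σ) := rfl

omit [LinearOrder κ] in
/-- `cochainSystemMap` of the identity (`rfl` componentwise). [cite: GortzWedhorn2023, Def. 21.68 (p. 180)] -/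
theorem cochainSystemMap_id (a : ℤ) : cochainSystemMap (𝟙 P) a = 𝟙 (cochainSystem P a) := by
  ext t g; rfl

omit [LinearOrder κ] in
/-- `cochainSystemMap` of a composite (`rfl` componentwise). [cite: GortzWedhorn2023, Def. 21.68 (p. 180)] -/
theorem cochainSystemMap_comp (a : ℤ) :
    cochainSystemMap (φ ≫ ψ) a = cochainSystemMap φ a ≫ cochainSystemMap ψ a := by
  ext t g; rfl

omit [LinearOrder κ] in
/-- **The induced maps commute with the `σ`-Čech differentials** (`sysD_sysCochainMap` at each `t`).
[cite: GortzWedhorn2023, Def. 21.68 (p. 180)] -/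
theorem cochainSystemD_naturality (a : ℤ) :
    cochainSystemD P a ≫ cochainSystemMap φ (a + 1) = cochainSystemMap φ a ≫ cochainSystemD P' a := by
  ext t g
  exact (sysD_sysCochainMap (((flipFunctor _ _ _).map φ).app t) g).symm

/-! ### §2 The induced morphism of bicomplexes -/

/-- **`Č•,•(φ) : Č•,•(P) → Č•,•(P')`** — columnwise the chain maps `sysComplexMap (cochainSystemMap φ a)`; they commute with the
outer (`σ`-) differentials by `cochainSystemD_naturality`. [cite: StacksProject, Tag 0BEC] [cite: StacksProject, Tag 012K] -/
def sysBicomplexMap : sysBicomplex P ⟶ sysBicomplex P' :=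
  CochainComplex.ofHom (fun a => sysComplexMap (cochainSystemMap φ a)) fun a => by
    rw [sysBicomplex_d, sysBicomplex_d, ← sysComplexMap_comp, ← sysComplexMap_comp, cochainSystemD_naturality]

/-- The columns of `Č•,•(φ)` (`rfl`). [cite: StacksProject, Tag 0BEC] -/
@[simp] theorem sysBicomplexMap_f (a : ℤ) : (sysBicomplexMap φ).f a = sysComplexMap (cochainSystemMap φ a) := rfl

/-- `Č•,•(φ)` on elements: `x ↦ ((τ, σ) ↦ φ σ τ (x τ σ))` (`rfl`). [cite: StacksProject, Tag 0BEC] -/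
theorem sysBicomplexMap_f_f_apply (a b : ℤ) (x : SysCochain (cochainSystem P a) b) (τ : Simplex κ b) (σ : Simplex ι a) :
    ((((sysBicomplexMap φ).f a).f b).hom x : SysCochain (cochainSystem P' a) b) τ σ =
      ((φ.app σ.1).app τ.1).hom ((x τ : SysCochain (P.flip.obj τ.1) a) σ) := rfl

/-- `Č•,•(𝟙) = 𝟙`. [cite: StacksProject, Tag 0BEC] -/
theorem sysBicomplexMap_id : sysBicomplexMap (𝟙 P) = 𝟙 (sysBicomplex P) := by
  ext a b x
  rfl

/-- `Č•,•(φ ≫ ψ) = Č•,•(φ) ≫ Č•,•(ψ)`. [cite: StacksProject, Tag 0BEC] -/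
theorem sysBicomplexMap_comp : sysBicomplexMap (φ ≫ ψ) = sysBicomplexMap φ ≫ sysBicomplexMap ψ := by
  ext a b x
  rfl

/-- `Č•,•(0) = 0`. [cite: StacksProject, Tag 012K] -/
theorem sysBicomplexMap_zero : sysBicomplexMap (0 : P ⟶ P') = 0 := by
  ext a b x
  rfl

/-- `Č•,•(φ + φ') = Č•,•(φ) + Č•,•(φ')`. [cite: StacksProject, Tag 012K] -/
theorem sysBicomplexMap_add (φ' : P ⟶ P') : sysBicomplexMap (φ + φ') = sysBicomplexMap φ + sysBicomplexMap φ' := by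
  ext a b x
  rfl

/-! ### §3 The functor `P ↦ Č•,•(P)` -/

variable (A ι κ) in
/-- **`P ↦ Č•,•(P)` as a functor** from pair-systems of `A`-modules to bicomplexes of `A`-modules.
[cite: StacksProject, Tag 0BEC] [cite: StacksProject, Tag 012K] -/
def sysBicomplexFunctor :
    (Finset ι ⥤ Finset κ ⥤ ModuleCat.{u} A) ⥤ HomologicalComplex₂ (ModuleCat.{u} A) (ComplexShape.up ℤ) (ComplexShape.up ℤ) where
  obj P := sysBicomplex P
  map φ := sysBicomplexMap φ
  map_id _ := sysBicomplexMap_id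
  map_comp φ ψ := sysBicomplexMap_comp φ ψ

/-- The functor `P ↦ Č•,•(P)` is additive (stated as a theorem; no instance is declared). [cite: StacksProject, Tag 012K] -/
theorem additive_sysBicomplexFunctor : (sysBicomplexFunctor A ι κ).Additive :=
  ⟨fun {_ _ φ φ'} => sysBicomplexMap_add φ φ'⟩

/-- **An isomorphism of pair-systems induces an isomorphism of ordered Čech bicomplexes.** [cite: StacksProject, Tag 0BEC] -/
def sysBicomplexMapIso (e : P ≅ P') : sysBicomplex P ≅ sysBicomplex P' :=
  (sysBicomplexFunctor A ι κ).mapIso e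

/-- The components of `sysBicomplexMapIso` (`rfl`; the inverse is `sysBicomplexMap e.inv`, also `rfl`). [cite: StacksProject, Tag 0BEC] -/
@[simp] theorem sysBicomplexMapIso_hom (e : P ≅ P') : (sysBicomplexMapIso e).hom = sysBicomplexMap e.hom := rfl

end OrderedCech

end Literature.Algebra.Homology

end
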